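import Literature.NumberTheory.LFunctions.LittlewoodZeroGapsChain
import Literature.NumberTheory.LFunctions.LittlewoodZeroGaps
import Literature.NumberTheory.LFunctions.ZetaZerosProofs
import HarnessLib

/-!
# Littlewood's theorem on the gaps between zero ordinates of `ζ` — PROOF

Trunk T-ANT (`Literature/NumberTheory/LFunctions`).  Third of three files: DISCHARGES the named fact
`Literature.NumberTheory.LFunctions.littlewood_zero_ordinate_gaps_shrink` of `LittlewoodZeroGaps.lean` (Titchmarsh, *The
Theory of the Riemann Zeta-Function*, 2nd ed., Thm 9.11 «the gaps between the ordinates of successive zeros of `ζ(s)` tend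
to `0`»; Thm 9.12 is the quantitative refinement), so that its users
(`Summit.RiemannHypothesis.RiemannHypothesis.Theorems.Splittings.BombieriTruncSynthesisScreening…`) become unconditional in it.

Proof (Titchmarsh §9.12, first proof, with a FIXED width; inputs `LittlewoodZeroGapsInputs.lean`, chain
`LittlewoodZeroGapsChain.lean`): given `δ > 0` put `δ' = min δ ½`, `n = ⌈28/δ'⌉`, `h = 7/(2n)` (so `4h ≤ δ'/2`),
`b = 1 − log 2/log 3`, `C = 4·8^{n+2}`, `U = max 21 (C^{1/bⁿ})`, `T₁ = max 8 (exp U)`.  If `T ≥ T₁` and no zero of `ζ` has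
ordinate in `[T − δ, T + δ]`, the box `−1 ≤ σ ≤ 4`, `|t − T| ≤ 4h` is zero-free, the chain gives a branch `L` of `log ζ`
at `−1/2 + iT` with `‖L‖ ≤ 2^{bⁿ} K^{1−bⁿ}`, `K = 8^{n+1}(3 log(T+5)+2) ≤ 4·8^{n+1} u`, `u = log(T+5) ≤ log T + 1`, while
the functional equation gives `Re L = log ‖ζ(−1/2+iT)‖ ≥ log T − 9`; since `u^{bⁿ} ≥ C` this forces
`log T − 9 ≤ u/4 ≤ (log T + 1)/4`, i.e. `log T ≤ 37/3 < 21 ≤ U ≤ log T` — contradiction.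

* `LittlewoodZeroGaps.exists_zero_im_near` — `∀ δ > 0, ∃ T₁, ∀ T ≥ T₁, ∃ ρ, ζ ρ = 0 ∧ |Im ρ − T| ≤ δ ∧ 0 < Re ρ < 1`;
* `LittlewoodZeroGaps.exists_nontrivialZero_im_near` — the same with `ρ ∈ ZetaZeros.riemannZetaNontrivialZeros`;
* `littlewood_zero_ordinate_gaps_shrink_holds : littlewood_zero_ordinate_gaps_shrink` — the discharge (D-0026: debt −1).

Sorry-free, standard axioms; no instances, no notation.  Provenance: cell rh-split, seat rh-split-typer-2 g4.
-/

noncomputable section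

open Complex Metric Set Real Filter Topology

namespace Literature.NumberTheory.LFunctions

namespace LittlewoodZeroGaps

set_option maxHeartbeats 400000 in
/-- **Littlewood's theorem, qualitative form** (Titchmarsh Thm 9.11; proof = Titchmarsh §9.12, first proof, run
with a FIXED `δ`): for every `δ > 0` and all large `T`, `ζ` has a zero `ρ` with `|Im ρ − T| ≤ δ` (and then
`0 < Re ρ < 1`). [cite: Titchmarsh1986, Thm 9.11] -/
theorem exists_zero_im_near (δ : ℝ) (hδ : 0 < δ) :
    ∃ T₁ : ℝ, ∀ T : ℝ, T₁ ≤ T →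
      ∃ ρ : ℂ, riemannZeta ρ = 0 ∧ |ρ.im - T| ≤ δ ∧ 0 < ρ.re ∧ ρ.re < 1 := by
  -- the width actually used, the number of circles and the step
  obtain ⟨δ', hδ'def⟩ : ∃ δ' : ℝ, δ' = min δ (1 / 2) := ⟨_, rfl⟩
  have hδ'0 : 0 < δ' := by rw [hδ'def]; exact lt_min hδ (by norm_num)
  have hδ'δ : δ' ≤ δ := by rw [hδ'def]; exact min_le_left _ _
  have hδ'h : δ' ≤ 1 / 2 := by rw [hδ'def]; exact min_le_right _ _
  obtain ⟨n, hndef⟩ : ∃ n : ℕ, n = ⌈28 / δ'⌉₊ := ⟨_, rfl⟩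
  have hn28 : 28 / δ' ≤ n := by rw [hndef]; exact Nat.le_ceil _
  have h56 : (56 : ℝ) ≤ 28 / δ' := by rw [le_div_iff₀ hδ'0]; linarith
  have hn56 : (56 : ℝ) ≤ n := h56.trans hn28
  have hn0 : (0 : ℝ) < n := by linarith
  obtain ⟨h, hhdef⟩ : ∃ h : ℝ, h = 7 / (2 * n) := ⟨_, rfl⟩
  have hh : 0 < h := by rw [hhdef]; positivity
  have hnh : (n : ℝ) * h = 7 / 2 := by rw [hhdef]; field_simp
  have hh8 : h ≤ 1 / 8 := by
    rw [hhdef, div_le_iff₀ (by positivity)]; linarith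
  have h4δ : 4 * h ≤ δ' := by
    -- `4h = 14/n ≤ 14 δ'/28 = δ'/2`
    have : 4 * h * n = 14 := by rw [hhdef]; field_simp; ring
    have h2 : δ' * (28 / δ') = 28 := by field_simp
    nlinarith [mul_le_mul_of_nonneg_left hn28 hδ'0.le]
  -- the exponent `b` and the threshold
  obtain ⟨b, hbdef⟩ : ∃ b : ℝ, b = 1 - Real.log 2 / Real.log 3 := ⟨_, rfl⟩
  have hb : 0 < b ∧ b < 1 := by rw [hbdef]; exact b_pos_lt_one
  have hbn : 0 < b ^ n := pow_pos hb.1 n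
  have hbn1 : b ^ n ≤ 1 := pow_le_one₀ hb.1.le hb.2.le
  obtain ⟨C, hCdef⟩ : ∃ C : ℝ, C = 4 * (8 : ℝ) ^ (n + 2) := ⟨_, rfl⟩
  have hC0 : 0 < C := by rw [hCdef]; positivity
  obtain ⟨U, hUdef⟩ : ∃ U : ℝ, U = max 21 (C ^ (1 / b ^ n)) := ⟨_, rfl⟩
  have hU21 : 21 ≤ U := by rw [hUdef]; exact le_max_left _ _
  have hUC : C ^ (1 / b ^ n) ≤ U := by rw [hUdef]; exact le_max_right _ _
  refine ⟨max 8 (Real.exp U), fun T hT ↦ ?_⟩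
  have hT8 : 8 ≤ T := (le_max_left _ _).trans hT
  have hTU : Real.exp U ≤ T := (le_max_right _ _).trans hT
  have hT0 : 0 < T := by linarith
  have hlogT : U ≤ Real.log T := by
    rw [Real.le_log_iff_exp_le hT0]; exact hTU
  by_contra hno
  push Not at hno
  -- zero-freeness of the box
  have hzf : ∀ z : ℂ, -1 ≤ z.re → z.re ≤ 4 → |z.im - T| ≤ 4 * h → riemannZeta z ≠ 0 := by
    intro z _ _ hz h0
    have him : z.im ≠ 0 := by
      have := neg_abs_le (z.im - T)
      intro him; linarith
    obtain ⟨h1, h2⟩ := re_mem_Ioo_of_riemannZeta_eq_zero_of_im_ne_zero h0 him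
    exact absurd h2 (not_lt.2 (hno z h0 (hz.trans (h4δ.trans hδ'δ)) h1))
  -- the chain at `ν = n`: centre `-1/2 + iT`
  obtain ⟨L, hLd, -, hLexp, -, hL2⟩ := chain hT8 hh hh8 hnh hzf n le_rfl
  have hcn : ((3 - (n : ℕ) * h : ℝ) : ℂ) + T * I = -1 / 2 + T * I := by
    have : (3 - (n : ℝ) * h) = -1 / 2 := by rw [hnh]; norm_num
    rw [this]; push_cast; ring
  have h4h : (0 : ℝ) < 4 * h := by positivity
  have hcmem : ((3 - (n : ℕ) * h : ℝ) : ℂ) + T * I ∈ ball (((3 - (n : ℕ) * h : ℝ) : ℂ) + T * I) (4 * h) :=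
    mem_ball_self h4h
  -- upper bound at the centre
  set K : ℝ := (8 : ℝ) ^ (n + 1) * (3 * Real.log (T + 5) + 2) with hK
  have hup : ‖L (-1 / 2 + T * I)‖ ≤ (2 : ℝ) ^ (b ^ n) * K ^ (1 - b ^ n) := by
    have := hL2 (((3 - (n : ℕ) * h : ℝ) : ℂ) + T * I) (by simp; positivity)
    rw [hcn] at this; rw [hbdef]; exact this
  -- lower bound at the centre
  have hlow : Real.log T - 9 ≤ ‖L (-1 / 2 + T * I)‖ := by
    have hre : (L (-1 / 2 + T * I)).re = Real.log ‖riemannZeta (-1 / 2 + T * I)‖ := by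
      have := hLexp _ hcmem
      rw [hcn] at this
      rw [← this, norm_exp, Real.log_exp]
    calc Real.log T - 9 ≤ Real.log ‖riemannZeta (-1 / 2 + T * I)‖ :=
          log_norm_zeta_neg_half_ge (by linarith)
      _ = (L (-1 / 2 + T * I)).re := hre.symm
      _ ≤ |(L (-1 / 2 + T * I)).re| := le_abs_self _
      _ ≤ ‖L (-1 / 2 + T * I)‖ := abs_re_le_norm _
  -- the real-variable contradiction
  set u : ℝ := Real.log (T + 5) with hu
  have hu_ge : Real.log T ≤ u := Real.log_le_log hT0 (by linarith)
  have hu_le : u ≤ Real.log T + 1 := by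
    have h2T : T + 5 ≤ 2 * T := by linarith
    calc u ≤ Real.log (2 * T) := Real.log_le_log (by linarith) h2T
      _ = Real.log 2 + Real.log T := Real.log_mul (by norm_num) hT0.ne'
      _ ≤ Real.log T + 1 := by linarith [Real.log_two_lt_d9]
  have hu21 : 21 ≤ u := by linarith
  have hu0 : 0 < u := by linarith
  -- `u^{b^n} ≥ C`
  have hubn : C ≤ u ^ (b ^ n) := by
    have h1 : C ^ (1 / b ^ n) ≤ u := by linarith
    have h2 := Real.rpow_le_rpow (by positivity) h1 hbn.le
    rwa [← Real.rpow_mul hC0.le, one_div_mul_cancel hbn.ne', Real.rpow_one] at h2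
  -- `K ≤ 32 · 8^{n+1} · u`... : `K ≤ 8^{n+1} (4u)`
  have hK4 : K ≤ (8 : ℝ) ^ (n + 1) * 4 * u := by
    rw [hK]; nlinarith [pow_pos (by norm_num : (0:ℝ) < 8) (n + 1)]
  have hK0 : 0 < K := by rw [hK]; positivity
  have hX1 : (1 : ℝ) ≤ (8 : ℝ) ^ (n + 1) * 4 := by nlinarith [one_le_pow₀ (by norm_num : (1:ℝ) ≤ 8) (n := n + 1)]
  -- `K^{1-b^n} ≤ (8^{n+1}·4) · u^{1-b^n} = (8^{n+1}·4) · u / u^{b^n} ≤ (8^{n+1}·4) u / C = u/8... `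
  have hstep1 : K ^ (1 - b ^ n) ≤ ((8 : ℝ) ^ (n + 1) * 4 * u) ^ (1 - b ^ n) :=
    Real.rpow_le_rpow hK0.le hK4 (by linarith)
  have hstep2 : ((8 : ℝ) ^ (n + 1) * 4 * u) ^ (1 - b ^ n) ≤ (8 : ℝ) ^ (n + 1) * 4 * (u / C) := by
    rw [Real.mul_rpow (by positivity) hu0.le]
    have ha : ((8 : ℝ) ^ (n + 1) * 4) ^ (1 - b ^ n) ≤ (8 : ℝ) ^ (n + 1) * 4 := by
      calc ((8 : ℝ) ^ (n + 1) * 4) ^ (1 - b ^ n) ≤ ((8 : ℝ) ^ (n + 1) * 4) ^ (1 : ℝ) :=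
            Real.rpow_le_rpow_of_exponent_le hX1 (by linarith)
        _ = _ := Real.rpow_one _
    have hb' : u ^ (1 - b ^ n) ≤ u / C := by
      rw [Real.rpow_sub hu0, Real.rpow_one]
      exact div_le_div_of_nonneg_left hu0.le hC0 hubn
    exact mul_le_mul ha hb' (by positivity) (by positivity)
  have h2bn : (2 : ℝ) ^ (b ^ n) ≤ 2 := by
    calc (2 : ℝ) ^ (b ^ n) ≤ (2 : ℝ) ^ (1 : ℝ) := Real.rpow_le_rpow_of_exponent_le (by norm_num) hbn1
      _ = 2 := Real.rpow_one _
  have hfin : (2 : ℝ) ^ (b ^ n) * K ^ (1 - b ^ n) ≤ u / 4 := by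
    have hKpow0 : 0 ≤ K ^ (1 - b ^ n) := by positivity
    calc (2 : ℝ) ^ (b ^ n) * K ^ (1 - b ^ n) ≤ 2 * ((8 : ℝ) ^ (n + 1) * 4 * (u / C)) := by
          nlinarith [hstep1.trans hstep2]
      _ = u / 4 := by rw [hCdef]; field_simp; ring
  linarith

/-- The same with membership in the tree's set of non-trivial zeros. [cite: Titchmarsh1986, Thm 9.11] -/
theorem exists_nontrivialZero_im_near (δ : ℝ) (hδ : 0 < δ) :
    ∃ T₁ : ℝ, ∀ T : ℝ, T₁ ≤ T →
      ∃ ρ ∈ ZetaZeros.riemannZetaNontrivialZeros, |ρ.im - T| ≤ δ := by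
  obtain ⟨T₁, hT₁⟩ := exists_zero_im_near δ hδ
  refine ⟨T₁, fun T hT ↦ ?_⟩
  obtain ⟨ρ, h0, him, h1, h2⟩ := hT₁ T hT
  exact ⟨ρ, mem_riemannZetaNontrivialZeros_iff_holds.2 ⟨h0, h1, h2⟩, him⟩

end LittlewoodZeroGaps

/-- **Littlewood's theorem (Titchmarsh Thm 9.11 / 9.12, qualitative form) holds**: the named fact
`littlewood_zero_ordinate_gaps_shrink` — for every `ε > 0`, every sufficiently large `T` is within `ε` of the ordinate of a
non-trivial zero of `ζ` — is a theorem of the tree (discharge; D-0026 debt −1). [cite: Titchmarsh1986, Thm 9.11] -/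
theorem littlewood_zero_ordinate_gaps_shrink_holds : littlewood_zero_ordinate_gaps_shrink :=
  fun ε hε ↦ LittlewoodZeroGaps.exists_nontrivialZero_im_near ε hε

end Literature.NumberTheory.LFunctions

end
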